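/-
Copyright (c) 2026 the pub-hodgecm-mathlib formalisation cell (harness21).  Prover seat hodgecm-mathlib-LH4-p17 (g3) (Track A «FOUR-FRAME» free hand routed to L1 by the
CHAIR VALVE; LEAD F0P6-plan (g15) BATCH #261 «the by-name ASSEMBLY of the block-D arch column at `φ′ := Σ j, ρ`»; block-D desk K2Liu-p12 (g6) TABLE v3.4 «D-arch column»;
tie K2E3-typ4 (g3) v26 :761–:763 (the six D-1 slots `Aloc Acw hAcw hAw cA hAinf` of ★ p864094 `hdead_blockD_of_record`)), Track B «K2-LIT», #184♮ = hLiu418 = `stmt-HodgeConjecture-24832`.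
THEOREMS ONLY (no `def`, no instance, no notation, no named-fact hypothesis, no `sorry`, default heartbeats).
-/
import Summits.HodgeConjecture.HodgeConjecture.Theorems.K2LiuIncoherentRankOneArchPlaceLettersOfScalarType  -- ★ p864236 (D-arch-loc): `hAcw_of_archLocalLetters`, `hAw_of_archLocalLetters`
import Summits.HodgeConjecture.HodgeConjecture.Theorems.K2LiuIncoherentRankOneArchHaarConstantBound       -- ★ p864594 (D-arch-Haar-1): `hcA_of_constTransport` (brings ★ p864260 (D-arch-Fub))
import Summits.HodgeConjecture.HodgeConjecture.Theorems.K2LiuIncoherentRankOneArchPlacePresentation        -- ★ p864502 (D-arch-P): `hdec_of_flatTubePresentation`, `hAint_of_flatTubePresentation`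
import Summits.HodgeConjecture.HodgeConjecture.Theorems.K2LiuIncoherentRankOneFaceRefinement               -- ★ p864397: the refined faces `(I X h).sigma (R X)`
import HarnessLib

/-!
# Crux `HLiu418`, #42S organ S5, BLOCK D — `K2LiuIncoherentRankOneBlockDArchOfRecord`: THE ARCH COLUMN OF BLOCK D BY NAME AT THE REFINED FACES
# (the six D-1 slots `Aloc Acw hAcw hAw cA hAinf` of ★ p864094 `hdead_blockD_of_record`, at `φ′ := Σ j, ρ`, from the record's readings — ★ p864236 ∘ ★ p864260 ∘ ★ p864502 ∘ ★ p864594)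

Cell `hodgecm-mathlib`, crux item hLiu418 = `stmt-HodgeConjecture-24832`, route `HCCMUnconditional`; squad K2 ∕ K2Liu (L1, LEAD F0P6-plan (g15)).  Lane
`--supports stmt-HodgeConjecture-24832 --as helper` (count-neutral).  CLOSES NO SOCKET.

THE SLOTS (K2E3-typ4 (g3) `TieProbe_42S` v26 :761–:763; block-D desk TABLE v3.4 «D-arch column»).  In the #42S tie, block D is ★ p864094
`K2LiuIncoherentRankOneBlockDLettersOfRecord.hdead_blockD_of_record … hEq A hAc hA Aloc Acw hAcw hAw cA hAinf hbad hα0 σflat hcorner hAzero cP hint hPval hS hram hD°`; its D-1 per-place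
letters `Aloc Acw hAcw hAw` and place tensor `cA hAinf` are six `sorry`s.  This file DISCHARGES ALL SIX BY NAME at the REFINED faces `I′ X h := (I X h).sigma (R X)` (★ p864397 — the
(KW-fac) face `j` split into its flat-tube terms `r`, so that each fine face is place-pure), for the EXPLICIT fine raw blocks of ★ p864502
  `A′ X p s h := ∫ χ_X(u) · (γ_p(s) · ∏_w Fs_{p,w}(s)(Frpt X h u w)) dν₀`,
with EXPLICIT data
  `Aloc X p w s h := ∫ Θ X p ⟨w⟩ s (Frg X h ⟨w⟩) (nfr ⟨w⟩ ρ) dρ`,   `Acw X p w s h := Ac₀ X p w s (Frg X h ⟨w⟩)`,   `cA X h p := ↑c₀`,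
  `Θ X p w s g m := [w = w₀ ? γ X p s : 1] · eb X w (blk m) · Fs X p w s (Frx X w · m · g)`   (★ p864502's `Ψloc` with the right frame factor as the LOCAL POINT `g`),
from the record's letters BY VALUE and nothing else:
(E) the character read through the frame `heb` (★ p863743), (M) the frame of the translated point `hFrpt` (★ `frame_mul`) and the UNITARITY of its right factor `hcomp` (★ `frame_mem`),
(T) is built into `A′` (★ `exists_flat_tube_presentation`'s terms `γ Fs`), (H) ONE archimedean carrier `ν₀` with ONE transport constant `c₀` (`htrans₀` — ★ `exists_integral_frame_eq_smul`
at `ν₀`; one carrier for all `(X,h)` by ★ `K2LiuKindWArchCarrierUniform.νinf_eq_of_factorisation`), and (C) the LOCAL CONTINUATION letters per fine face and place on `U(J)(ℂ)`: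
`Ac₀` holomorphic on `{0 < re}` at every `gᴴJg = J` (`hAc₀`) and agreeing there with the local integral `∫ Θ … g (nfr ρ) dρ` on `{½ < re}` (`hA₀`) — the ARCH-CONT lineage's letters
(★ p864004 ∕ ★ p863717 at the index datum of the fine face; C131-p02).
* **`blockD_arch_of_record`** — THE HEAD: `hAcw ∧ hAw ∧ hAinf` (★ p864094's three D-1 letter TYPES VERBATIM at `φ′`, at the explicit `Aloc Acw cA` above and `A := A′`).  So v27 reads
  `obtain ⟨hAcw, hAw, hAinf⟩ := blockD_arch_of_record …` and passes `A′ _ _ Aloc Acw hAcw hAw cA hAinf` — six slots → one name (+ the fine `hAc′ hA′` of the ARCH-CONT payer for `A′`).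
* (★ p864498's (iii) `hcA` at the same constant `cA` is ★ p864594 `hcA_of_constTransport … (fun _ _ => c₀) c₀ (fun _ _ => rfl)` — K1a desk WORD #5 (c), one payer for both.)
* **`hdec_of_record`** — the RAW face decomposition `A X j s h = Σ_{r ∈ R X j} A′ X ⟨j,r⟩ s h` on `{1 < re}` for the COARSE raw block read as ★ p863805 (b)'s integral against `ν₀`
  (`hAint₀`, `hpres`, per-term `hint`; ★ p864502) — the `hdec` input of ★ p864397 `ac_eq_sum_of_rawDecomposition` (the all-`s` `hdecAc` of `hEq_sigma_of_faceDecomposition` is then the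
  ARCH-CONT payer's DEFINITION `Ac X j := Σ_r Ac′ X ⟨j,r⟩`).
HONEST LABEL.  Count-neutral assembler (no new mathematics: four ★ heads composed, `rfl` readings); by value behind it, named: (E) ★ p863743 at `S := single b b (σc X)`, (M) ★ `frame_mul` ∕
★ `frame_mem` at `(w_Δ)_∞ · u · (gc X·h)_∞·g`, (T) ★ `exists_flat_tube_presentation` for the (KW-fac) faces, (H) ★ `exists_integral_frame_eq_smul` + ★ `νinf_eq_of_factorisation`,
★ p863805 (b) `hAint₀`, per-term integrability (★ `integrable_prod_unipDeltaArch_of_record` × character), and (C) the local continuations (ARCH-CONT, C131-p02); `HC_CM` is proved only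
modulo the 7 printed citations (2 remaining named inputs: hLiu418 = `stmt-HodgeConjecture-24832`, h413 = `stmt-HodgeConjecture-24833`) until rung 0 closes.

## References
* [KudlaRallis1994] S. Kudla, S. Rallis, *A regularized Siegel–Weil formula: the first term identity*, Ann. of Math. 140 (1994): §2 (2.10)–(2.12).
* [Shimura1997] G. Shimura, *Euler Products and Eisenstein Series*, CBMS 93 (1997): §16.4, §18.1 (18.4), §18.4.
* [Shimura1982] G. Shimura, *Confluent hypergeometric functions on tube domains*, Math. Ann. 260 (1982): §4 Thm. 4.2.
* [Tate1967] J. Tate, *Fourier analysis in number fields and Hecke's zeta-functions* (Cassels–Fröhlich 1967): §3 Thm. 3.3.1.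
* [Folland1995] G. B. Folland, *A Course in Abstract Harmonic Analysis* (1995): §2.2.
-/

set_option autoImplicit false
set_option linter.dupNamespace false -- the mandated namespace repeats `HodgeConjecture.HodgeConjecture`

noncomputable section

open scoped Matrix NNReal
open MeasureTheory NumberField NumberField.InfinitePlace IsDedekindDomain
open Literature.NumberTheory.Automorphic Literature.NumberTheory.Automorphic.UnitaryGroup Literature.NumberTheory.GaloisRepresentations
open Literature.NumberTheory.GelbartRogawski1991 Literature.NumberTheory.GelbartRogawski1991.GRConstruction

namespace Summit.HodgeConjecture.HodgeConjecture.Cruxes.HLiu418.K2LiuIncoherentRankOneBlockDArchOfRecord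

open K2LiuSiegelUnipotentFourierDefs
open K2LiuIncoherentRankOneArchPlaceLettersOfScalarType (hAcw_of_archLocalLetters hAw_of_archLocalLetters)
open K2LiuIncoherentRankOneArchPlaceTensor (hAinf_comp_of_frameTensor)
open K2LiuIncoherentRankOneArchHaarConstantBound (hcA_of_constTransport)
open K2LiuIncoherentRankOneArchPlacePresentation (hdec_of_flatTubePresentation hAint_of_flatTubePresentation)

section Frame

variable (L : Type) [Field L] [NumberField L] [IsCMField L]

variable {N M n : ℕ} (e : Fin N × Fin M ≃ Fin n)
  (dV : Fin N → L) (hdV : ∀ i, IsCMField.complexConj L (dV i) = dV i)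
  (dW : Fin M → L) (hdW : ∀ i, IsCMField.complexConj L (dW i) = dW i)

/-- **THE ARCH COLUMN OF BLOCK D BY NAME (the head).**  At the refined faces `I′ X h := (I X h).sigma (R X)` and for the EXPLICIT fine raw blocks
`A′ X p s h := ∫ χ X u · (γ X p s · ∏_w Fs X p w s (Frpt X h u w)) dν₀`, the three D-1 letters of ★ p864094 `hdead_blockD_of_record` — `hAcw`, `hAw`, `hAinf` (types VERBATIM at `φ′ := Σ j, ρ`)
— hold at the EXPLICIT data `Aloc X p w s h := ∫ Θ X p ⟨w⟩ s (Frg X h ⟨w⟩) (nfr ⟨w⟩ ρ) dρ`, `Acw X p w s h := Ac₀ X p w s (Frg X h ⟨w⟩)`, `cA X h p := ↑c₀`,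
`Θ X p w s g m := [w = w₀ ? γ X p s : 1] · eb X w (blk m) · Fs X p w s (Frx X w · m · g)`, from the record's letters (E) `heb`, (M) `hFrpt hcomp`, (H) `htrans₀`, (C) `hAc₀ hA₀` BY VALUE
(★ p864236 ∘ ★ p864260 ∘ ★ p864502).  [cite: KudlaRallis1994, §2 (2.10)–(2.12)] [cite: Shimura1997, §18.4] [cite: Shimura1982, §4 Thm. 4.2] [cite: Tate1967, §3 Thm. 3.3.1] -/
theorem blockD_arch_of_record {φ ρ Ω B Rc : Type*} [MeasurableSpace Ω] [Fintype {w : InfinitePlace L // w.IsComplex}] [DecidableEq {w : InfinitePlace L // w.IsComplex}]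
    [MeasureSpace Rc] [SigmaFinite (volume : Measure Rc)]
    (I : skewMatrices ((IsCMField.complexConj L : L ≃ₐ[Fp L] L) : L →+* L) ((gramR L e dV hdV dW hdW).map (algebraMap (Fp L) L)) → HA L e dV hdV dW hdW → Finset φ)
    (R : skewMatrices ((IsCMField.complexConj L : L ≃ₐ[Fp L] L) : L →+* L) ((gramR L e dV hdV dW hdW).map (algebraMap (Fp L) L)) → φ → Finset ρ)
    (Tinf : Finset (InfinitePlace L)) (hall : ∀ w : InfinitePlace L, w ∈ Tinf)
    (w₀ : {w : InfinitePlace L // w.IsComplex}) (blk : Matrix (Fin 2 ⊕ Fin 2) (Fin 2 ⊕ Fin 2) ℂ → B)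
    -- (M) the frames: of the unipotent, of the left point `(w_Δ)_∞`, of the right point `(gc X·h)_∞·g`, of the translated point; multiplicativity and unitarity of the right factor
    (FrΩ : Ω → {w : InfinitePlace L // w.IsComplex} → Matrix (Fin 2 ⊕ Fin 2) (Fin 2 ⊕ Fin 2) ℂ)
    (Frx : skewMatrices ((IsCMField.complexConj L : L ≃ₐ[Fp L] L) : L →+* L) ((gramR L e dV hdV dW hdW).map (algebraMap (Fp L) L)) → {w : InfinitePlace L // w.IsComplex} →
      Matrix (Fin 2 ⊕ Fin 2) (Fin 2 ⊕ Fin 2) ℂ)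
    (Frg : skewMatrices ((IsCMField.complexConj L : L ≃ₐ[Fp L] L) : L →+* L) ((gramR L e dV hdV dW hdW).map (algebraMap (Fp L) L)) → HA L e dV hdV dW hdW →
      {w : InfinitePlace L // w.IsComplex} → Matrix (Fin 2 ⊕ Fin 2) (Fin 2 ⊕ Fin 2) ℂ)
    (Frpt : skewMatrices ((IsCMField.complexConj L : L ≃ₐ[Fp L] L) : L →+* L) ((gramR L e dV hdV dW hdW).map (algebraMap (Fp L) L)) → HA L e dV hdV dW hdW → Ω →
      {w : InfinitePlace L // w.IsComplex} → Matrix (Fin 2 ⊕ Fin 2) (Fin 2 ⊕ Fin 2) ℂ)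
    (hFrpt : ∀ (X : skewMatrices ((IsCMField.complexConj L : L ≃ₐ[Fp L] L) : L →+* L) ((gramR L e dV hdV dW hdW).map (algebraMap (Fp L) L))) (h : HA L e dV hdV dW hdW) (u : Ω)
      (w : {w : InfinitePlace L // w.IsComplex}), Frpt X h u w = Frx X w * FrΩ u w * Frg X h w)
    (hcomp : ∀ (X : skewMatrices ((IsCMField.complexConj L : L ≃ₐ[Fp L] L) : L →+* L) ((gramR L e dV hdV dW hdW).map (algebraMap (Fp L) L))) (h : HA L e dV hdV dW hdW), ∀ w ∈ Tinf,
      (Frg X h ⟨w, IsTotallyComplex.isComplex w⟩)ᴴ * Matrix.J (Fin 2) ℂ * Frg X h ⟨w, IsTotallyComplex.isComplex w⟩ = Matrix.J (Fin 2) ℂ)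
    -- (E) the character read through the frame
    (χ : skewMatrices ((IsCMField.complexConj L : L ≃ₐ[Fp L] L) : L →+* L) ((gramR L e dV hdV dW hdW).map (algebraMap (Fp L) L)) → Ω → ℂ)
    (eb : skewMatrices ((IsCMField.complexConj L : L ≃ₐ[Fp L] L) : L →+* L) ((gramR L e dV hdV dW hdW).map (algebraMap (Fp L) L)) → {w : InfinitePlace L // w.IsComplex} → B → ℂ)
    (heb : ∀ (X : skewMatrices ((IsCMField.complexConj L : L ≃ₐ[Fp L] L) : L →+* L) ((gramR L e dV hdV dW hdW).map (algebraMap (Fp L) L))) (u : Ω),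
      χ X u = ∏ w, eb X w (blk (FrΩ u w)))
    -- (T) the flat-tube terms of the refined faces
    (γ : skewMatrices ((IsCMField.complexConj L : L ≃ₐ[Fp L] L) : L →+* L) ((gramR L e dV hdV dW hdW).map (algebraMap (Fp L) L)) → (Sigma fun _ : φ => ρ) → ℂ → ℂ)
    (Fs : skewMatrices ((IsCMField.complexConj L : L ≃ₐ[Fp L] L) : L →+* L) ((gramR L e dV hdV dW hdW).map (algebraMap (Fp L) L)) → (Sigma fun _ : φ => ρ) →
      {w : InfinitePlace L // w.IsComplex} → ℂ → Matrix (Fin 2 ⊕ Fin 2) (Fin 2 ⊕ Fin 2) ℂ → ℂ)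
    -- (H) ONE archimedean carrier and its ONE transport constant through the frame
    (ν₀ : Measure Ω) (nfr : {w : InfinitePlace L // w.IsComplex} → Rc → Matrix (Fin 2 ⊕ Fin 2) (Fin 2 ⊕ Fin 2) ℂ) (c₀ : ℝ≥0)
    (htrans₀ : ∀ Ψ : ({w : InfinitePlace L // w.IsComplex} → Matrix (Fin 2 ⊕ Fin 2) (Fin 2 ⊕ Fin 2) ℂ) → ℂ,
      ∫ u, Ψ (FrΩ u) ∂ν₀ = c₀ • ∫ r : {w : InfinitePlace L // w.IsComplex} → Rc, Ψ (fun w => nfr w (r w)))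
    -- (C) the local continuations per fine face and place on `U(J)(ℂ)` (ARCH-CONT): holomorphy, and agreement with the local integral on `{½ < re}`
    (Ac₀ : skewMatrices ((IsCMField.complexConj L : L ≃ₐ[Fp L] L) : L →+* L) ((gramR L e dV hdV dW hdW).map (algebraMap (Fp L) L)) → (Sigma fun _ : φ => ρ) → InfinitePlace L → ℂ →
      Matrix (Fin 2 ⊕ Fin 2) (Fin 2 ⊕ Fin 2) ℂ → ℂ)
    (hAc₀ : ∀ X : skewMatrices ((IsCMField.complexConj L : L ≃ₐ[Fp L] L) : L →+* L) ((gramR L e dV hdV dW hdW).map (algebraMap (Fp L) L)),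
      (X : Matrix (Fin n) (Fin n) L) ≠ 0 → (X : Matrix (Fin n) (Fin n) L).det = 0 → ∀ (h : HA L e dV hdV dW hdW), ∀ p ∈ (I X h).sigma (R X), ∀ w ∈ Tinf,
        ∀ g : Matrix (Fin 2 ⊕ Fin 2) (Fin 2 ⊕ Fin 2) ℂ, gᴴ * Matrix.J (Fin 2) ℂ * g = Matrix.J (Fin 2) ℂ → DifferentiableOn ℂ (fun s => Ac₀ X p w s g) {s : ℂ | 0 < s.re})
    (hA₀ : ∀ X : skewMatrices ((IsCMField.complexConj L : L ≃ₐ[Fp L] L) : L →+* L) ((gramR L e dV hdV dW hdW).map (algebraMap (Fp L) L)),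
      (X : Matrix (Fin n) (Fin n) L) ≠ 0 → (X : Matrix (Fin n) (Fin n) L).det = 0 → ∀ (h : HA L e dV hdV dW hdW), ∀ p ∈ (I X h).sigma (R X), ∀ w ∈ Tinf,
        ∀ s : ℂ, 1 / 2 < s.re → ∀ g : Matrix (Fin 2 ⊕ Fin 2) (Fin 2 ⊕ Fin 2) ℂ, gᴴ * Matrix.J (Fin 2) ℂ * g = Matrix.J (Fin 2) ℂ →
          (fun X (p : Sigma fun _ : φ => ρ) (w : InfinitePlace L) s (g : Matrix (Fin 2 ⊕ Fin 2) (Fin 2 ⊕ Fin 2) ℂ) =>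
              ∫ ρ' : Rc, (if (⟨w, IsTotallyComplex.isComplex w⟩ : {w : InfinitePlace L // w.IsComplex}) = w₀ then γ X p s else 1) *
                eb X ⟨w, IsTotallyComplex.isComplex w⟩ (blk (nfr ⟨w, IsTotallyComplex.isComplex w⟩ ρ')) *
                Fs X p ⟨w, IsTotallyComplex.isComplex w⟩ s (Frx X ⟨w, IsTotallyComplex.isComplex w⟩ * nfr ⟨w, IsTotallyComplex.isComplex w⟩ ρ' * g)) X p w s g =
            Ac₀ X p w s g) :
    -- `hAcw` of ★ p864094 at `φ′`, `Acw := fun X p w s h => Ac₀ X p w s (Frg X h ⟨w⟩)`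
    (∀ X : skewMatrices ((IsCMField.complexConj L : L ≃ₐ[Fp L] L) : L →+* L) ((gramR L e dV hdV dW hdW).map (algebraMap (Fp L) L)),
      (X : Matrix (Fin n) (Fin n) L) ≠ 0 → (X : Matrix (Fin n) (Fin n) L).det = 0 → ∀ (h : HA L e dV hdV dW hdW), ∀ i ∈ (fun X h => (I X h).sigma (R X)) X h, ∀ w ∈ Tinf,
        DifferentiableOn ℂ (fun s => (fun X (p : Sigma fun _ : φ => ρ) (w : InfinitePlace L) s (h : HA L e dV hdV dW hdW) =>
          Ac₀ X p w s (Frg X h ⟨w, IsTotallyComplex.isComplex w⟩)) X i w s h) {s : ℂ | 0 < s.re}) ∧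
    -- `hAw` of ★ p864094 at `φ′`, `Aloc := fun X p w s h => ∫ Θ … (Frg X h ⟨w⟩) (nfr ⟨w⟩ ρ) dρ`
    (∀ X : skewMatrices ((IsCMField.complexConj L : L ≃ₐ[Fp L] L) : L →+* L) ((gramR L e dV hdV dW hdW).map (algebraMap (Fp L) L)),
      (X : Matrix (Fin n) (Fin n) L) ≠ 0 → (X : Matrix (Fin n) (Fin n) L).det = 0 → ∀ (h : HA L e dV hdV dW hdW), ∀ i ∈ (fun X h => (I X h).sigma (R X)) X h, ∀ w ∈ Tinf,
        ∀ s : ℂ, 1 / 2 < s.re →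
          (fun X (p : Sigma fun _ : φ => ρ) (w : InfinitePlace L) s (h : HA L e dV hdV dW hdW) =>
              ∫ ρ' : Rc, (if (⟨w, IsTotallyComplex.isComplex w⟩ : {w : InfinitePlace L // w.IsComplex}) = w₀ then γ X p s else 1) *
                eb X ⟨w, IsTotallyComplex.isComplex w⟩ (blk (nfr ⟨w, IsTotallyComplex.isComplex w⟩ ρ')) *
                Fs X p ⟨w, IsTotallyComplex.isComplex w⟩ s (Frx X ⟨w, IsTotallyComplex.isComplex w⟩ * nfr ⟨w, IsTotallyComplex.isComplex w⟩ ρ' *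
                  Frg X h ⟨w, IsTotallyComplex.isComplex w⟩)) X i w s h =
          (fun X (p : Sigma fun _ : φ => ρ) (w : InfinitePlace L) s (h : HA L e dV hdV dW hdW) => Ac₀ X p w s (Frg X h ⟨w, IsTotallyComplex.isComplex w⟩)) X i w s h) ∧
    -- `hAinf` of ★ p864094 at `φ′`, for the explicit fine raw blocks `A′`, `cA := fun _ _ _ => ↑c₀`
    (∀ X : skewMatrices ((IsCMField.complexConj L : L ≃ₐ[Fp L] L) : L →+* L) ((gramR L e dV hdV dW hdW).map (algebraMap (Fp L) L)),
      (X : Matrix (Fin n) (Fin n) L) ≠ 0 → (X : Matrix (Fin n) (Fin n) L).det = 0 → ∀ (h : HA L e dV hdV dW hdW), ∀ i ∈ (fun X h => (I X h).sigma (R X)) X h,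
        ∀ s : ℂ, 1 < s.re →
          (fun X (p : Sigma fun _ : φ => ρ) s (h : HA L e dV hdV dW hdW) => ∫ u, χ X u * (γ X p s * ∏ w, Fs X p w s (Frpt X h u w)) ∂ν₀) X i s h =
            (fun (_ : skewMatrices ((IsCMField.complexConj L : L ≃ₐ[Fp L] L) : L →+* L) ((gramR L e dV hdV dW hdW).map (algebraMap (Fp L) L)))
                (_ : HA L e dV hdV dW hdW) (_ : Sigma fun _ : φ => ρ) => ((c₀ : ℝ) : ℂ)) X h i *
              ∏ w ∈ Tinf, (fun X (p : Sigma fun _ : φ => ρ) (w : InfinitePlace L) s (h : HA L e dV hdV dW hdW) =>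
                ∫ ρ' : Rc, (if (⟨w, IsTotallyComplex.isComplex w⟩ : {w : InfinitePlace L // w.IsComplex}) = w₀ then γ X p s else 1) *
                  eb X ⟨w, IsTotallyComplex.isComplex w⟩ (blk (nfr ⟨w, IsTotallyComplex.isComplex w⟩ ρ')) *
                  Fs X p ⟨w, IsTotallyComplex.isComplex w⟩ s (Frx X ⟨w, IsTotallyComplex.isComplex w⟩ * nfr ⟨w, IsTotallyComplex.isComplex w⟩ ρ' *
                    Frg X h ⟨w, IsTotallyComplex.isComplex w⟩)) X i w s h) := by
  refine ⟨?_, ?_, ?_⟩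
  · exact hAcw_of_archLocalLetters L e dV hdV dW hdW (fun X h => (I X h).sigma (R X)) Tinf
      (fun X h w => Frg X h ⟨w, IsTotallyComplex.isComplex w⟩) hcomp Ac₀ hAc₀
  · exact hAw_of_archLocalLetters L e dV hdV dW hdW (fun X h => (I X h).sigma (R X)) Tinf
      (fun X h w => Frg X h ⟨w, IsTotallyComplex.isComplex w⟩) hcomp
      (fun X (p : Sigma fun _ : φ => ρ) (w : InfinitePlace L) s (g : Matrix (Fin 2 ⊕ Fin 2) (Fin 2 ⊕ Fin 2) ℂ) =>
        ∫ ρ' : Rc, (if (⟨w, IsTotallyComplex.isComplex w⟩ : {w : InfinitePlace L // w.IsComplex}) = w₀ then γ X p s else 1) *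
          eb X ⟨w, IsTotallyComplex.isComplex w⟩ (blk (nfr ⟨w, IsTotallyComplex.isComplex w⟩ ρ')) *
          Fs X p ⟨w, IsTotallyComplex.isComplex w⟩ s (Frx X ⟨w, IsTotallyComplex.isComplex w⟩ * nfr ⟨w, IsTotallyComplex.isComplex w⟩ ρ' * g))
      Ac₀ hA₀
  · exact hAinf_comp_of_frameTensor L e dV hdV dW hdW (fun X h => (I X h).sigma (R X)) Tinf hall
      (fun X (p : Sigma fun _ : φ => ρ) s (h : HA L e dV hdV dW hdW) => ∫ u, χ X u * (γ X p s * ∏ w, Fs X p w s (Frpt X h u w)) ∂ν₀)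
      (fun _ _ => ν₀)
      (fun X p s h u => ∏ w, (fun X (p : Sigma fun _ : φ => ρ) w s (h : HA L e dV hdV dW hdW) (m : Matrix (Fin 2 ⊕ Fin 2) (Fin 2 ⊕ Fin 2) ℂ) =>
        (if w = w₀ then γ X p s else 1) * eb X w (blk m) * Fs X p w s (Frx X w * m * Frg X h w)) X p w s h (FrΩ u w))
      (hAint_of_flatTubePresentation L e dV hdV dW hdW w₀ blk I R (fun _ _ => ν₀) FrΩ Frx Frg Frpt hFrpt χ eb heb γ Fs
        (fun X p s h => ∫ u, χ X u * (γ X p s * ∏ w, Fs X p w s (Frpt X h u w)) ∂ν₀) (fun _ _ _ _ _ _ _ _ _ _ => rfl))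
      FrΩ nfr (fun _ _ => c₀) (fun _ _ => htrans₀)
      (fun X (p : Sigma fun _ : φ => ρ) w s (h : HA L e dV hdV dW hdW) (m : Matrix (Fin 2 ⊕ Fin 2) (Fin 2 ⊕ Fin 2) ℂ) =>
        (if w = w₀ then γ X p s else 1) * eb X w (blk m) * Fs X p w s (Frx X w * m * Frg X h w))
      (fun _ _ _ _ _ _ _ _ => rfl)
      (fun X h w => Frg X h ⟨w, IsTotallyComplex.isComplex w⟩)
      (fun X (p : Sigma fun _ : φ => ρ) (w : InfinitePlace L) s (g : Matrix (Fin 2 ⊕ Fin 2) (Fin 2 ⊕ Fin 2) ℂ) =>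
        ∫ ρ' : Rc, (if (⟨w, IsTotallyComplex.isComplex w⟩ : {w : InfinitePlace L // w.IsComplex}) = w₀ then γ X p s else 1) *
          eb X ⟨w, IsTotallyComplex.isComplex w⟩ (blk (nfr ⟨w, IsTotallyComplex.isComplex w⟩ ρ')) *
          Fs X p ⟨w, IsTotallyComplex.isComplex w⟩ s (Frx X ⟨w, IsTotallyComplex.isComplex w⟩ * nfr ⟨w, IsTotallyComplex.isComplex w⟩ ρ' * g))
      (fun _ _ _ _ _ _ _ _ _ => rfl)

/-- **THE RAW FACE DECOMPOSITION AT THE CARRIER OF RECORD** (the `hdec` input of ★ p864397 `ac_eq_sum_of_rawDecomposition`): the COARSE raw block `A X j s h` read as ★ p863805 (b)'s integral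
`∫ χ X u · Φ X j s h u dν₀` (`hAint₀`), the slice presented by its flat-tube terms (`hpres`), per-term integrability (`hint`) ⟹ `A X j s h = Σ_{r ∈ R X j} A′ X ⟨j,r⟩ s h` on `{1 < re}` with
the EXPLICIT `A′` of the head (★ p864502 `hdec_of_flatTubePresentation` at `ν := fun _ _ => ν₀`). [cite: KudlaRallis1994, §2 (2.10)–(2.12)] [cite: Tate1967, §3 Thm. 3.3.1] -/
theorem hdec_of_record {φ ρ Ω : Type*} [MeasurableSpace Ω] [Fintype {w : InfinitePlace L // w.IsComplex}]
    (I : skewMatrices ((IsCMField.complexConj L : L ≃ₐ[Fp L] L) : L →+* L) ((gramR L e dV hdV dW hdW).map (algebraMap (Fp L) L)) → HA L e dV hdV dW hdW → Finset φ)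
    (R : skewMatrices ((IsCMField.complexConj L : L ≃ₐ[Fp L] L) : L →+* L) ((gramR L e dV hdV dW hdW).map (algebraMap (Fp L) L)) → φ → Finset ρ)
    (A : skewMatrices ((IsCMField.complexConj L : L ≃ₐ[Fp L] L) : L →+* L) ((gramR L e dV hdV dW hdW).map (algebraMap (Fp L) L)) → φ → ℂ → HA L e dV hdV dW hdW → ℂ)
    (Frpt : skewMatrices ((IsCMField.complexConj L : L ≃ₐ[Fp L] L) : L →+* L) ((gramR L e dV hdV dW hdW).map (algebraMap (Fp L) L)) → HA L e dV hdV dW hdW → Ω → {w : InfinitePlace L // w.IsComplex} → Matrix (Fin 2 ⊕ Fin 2) (Fin 2 ⊕ Fin 2) ℂ)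
    (χ : skewMatrices ((IsCMField.complexConj L : L ≃ₐ[Fp L] L) : L →+* L) ((gramR L e dV hdV dW hdW).map (algebraMap (Fp L) L)) → Ω → ℂ)
    (γ : skewMatrices ((IsCMField.complexConj L : L ≃ₐ[Fp L] L) : L →+* L) ((gramR L e dV hdV dW hdW).map (algebraMap (Fp L) L)) → (Sigma fun _ : φ => ρ) → ℂ → ℂ)
    (Fs : skewMatrices ((IsCMField.complexConj L : L ≃ₐ[Fp L] L) : L →+* L) ((gramR L e dV hdV dW hdW).map (algebraMap (Fp L) L)) → (Sigma fun _ : φ => ρ) → {w : InfinitePlace L // w.IsComplex} → ℂ → Matrix (Fin 2 ⊕ Fin 2) (Fin 2 ⊕ Fin 2) ℂ → ℂ)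
    (ν₀ : Measure Ω)
    (Φ : skewMatrices ((IsCMField.complexConj L : L ≃ₐ[Fp L] L) : L →+* L) ((gramR L e dV hdV dW hdW).map (algebraMap (Fp L) L)) → φ → ℂ → HA L e dV hdV dW hdW → Ω → ℂ)
    (hAint₀ : ∀ X : skewMatrices ((IsCMField.complexConj L : L ≃ₐ[Fp L] L) : L →+* L) ((gramR L e dV hdV dW hdW).map (algebraMap (Fp L) L)),
      (X : Matrix (Fin n) (Fin n) L) ≠ 0 → (X : Matrix (Fin n) (Fin n) L).det = 0 → ∀ (h : HA L e dV hdV dW hdW), ∀ j ∈ I X h, ∀ s : ℂ, 1 < s.re →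
        A X j s h = ∫ u, χ X u * Φ X j s h u ∂ν₀)
    (hpres : ∀ X : skewMatrices ((IsCMField.complexConj L : L ≃ₐ[Fp L] L) : L →+* L) ((gramR L e dV hdV dW hdW).map (algebraMap (Fp L) L)),
      (X : Matrix (Fin n) (Fin n) L) ≠ 0 → (X : Matrix (Fin n) (Fin n) L).det = 0 → ∀ (h : HA L e dV hdV dW hdW), ∀ j ∈ I X h, ∀ (s : ℂ) (u : Ω),
        Φ X j s h u = ∑ r ∈ R X j, γ X ⟨j, r⟩ s * ∏ w, Fs X ⟨j, r⟩ w s (Frpt X h u w))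
    (hint : ∀ X : skewMatrices ((IsCMField.complexConj L : L ≃ₐ[Fp L] L) : L →+* L) ((gramR L e dV hdV dW hdW).map (algebraMap (Fp L) L)),
      (X : Matrix (Fin n) (Fin n) L) ≠ 0 → (X : Matrix (Fin n) (Fin n) L).det = 0 → ∀ (h : HA L e dV hdV dW hdW), ∀ j ∈ I X h, ∀ r ∈ R X j, ∀ s : ℂ, 1 < s.re →
        Integrable (fun u => χ X u * (γ X ⟨j, r⟩ s * ∏ w, Fs X ⟨j, r⟩ w s (Frpt X h u w))) ν₀) :
    ∀ X : skewMatrices ((IsCMField.complexConj L : L ≃ₐ[Fp L] L) : L →+* L) ((gramR L e dV hdV dW hdW).map (algebraMap (Fp L) L)),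
      (X : Matrix (Fin n) (Fin n) L) ≠ 0 → (X : Matrix (Fin n) (Fin n) L).det = 0 → ∀ (h : HA L e dV hdV dW hdW), ∀ j ∈ I X h, ∀ s : ℂ, 1 < s.re →
        A X j s h = ∑ r ∈ R X j,
          (fun X (p : Sigma fun _ : φ => ρ) s (h : HA L e dV hdV dW hdW) => ∫ u, χ X u * (γ X p s * ∏ w, Fs X p w s (Frpt X h u w)) ∂ν₀) X ⟨j, r⟩ s h :=
  hdec_of_flatTubePresentation L e dV hdV dW hdW I A (fun _ _ => ν₀) χ Φ hAint₀ R γ Fs Frpt hpres (fun X hX0 hdet h j hj r hr s hs => hint X hX0 hdet h j hj r hr s hs)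

end Frame

end Summit.HodgeConjecture.HodgeConjecture.Cruxes.HLiu418.K2LiuIncoherentRankOneBlockDArchOfRecord

end
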